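import Summits.Ventures.PercRepro.C025ProfileCertBridge
import Summits.Ventures.PercRepro.C025ProfileRankFourDemA

/-!
# THE ROW `(3,4)` OF THE PROFILE INEQUALITY — the STAGED certificate (night-3 g12)
`proofs/NIGHT3-G12-STAGED.md`. The row `(3,4)` of `(Π)` (C-032) reads `4·#{S : ρ(S) = 4} ≥ Σ_{B : ρ(B) = 3, ρ(E∖B) ≥ 4} ρ(E∖B)`.
For a rank-`3` set `B` with `p := ρ(E∖B) ≥ 4` ("demanding") put `P := cl B`, `T := P ∖ B` (`inner`), `F := E ∖ P` (`outer`),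
`f := ρ(F)` and `j := p − f` (the rank the plane adds to its complement). The rule pays `B` on the sets `B ∪ {x}`, `x ∈ F`
(`e = 1`) and on the `Ls`-sets `B ∪ {y, x}`, `y ∈ T`, `x ∈ F`:
* the **basis part** `rb B x := 1` if `x` is a coloop of `F` (`ρ(F∖x) < f`), else `f/(f+1)` — it sums to `≥ f`;
* the **excess** `j` is shared equally by the points of `F`, `jsh B := j/|F|`, and at `S := B ∪ {x}` the share is TAKEN up to the
  allowance `allow S := max 0 (4 − rigid S) / #dcol S` (`dcol S` = the coloops `x` of `S` whose `S ∖ x` is a demanding rank-`3` set),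
  the rest (`ovf B x`) being spread uniformly ovf the `Ls`-sets `B ∪ {y, x}`, `y ∈ T`;
* the **rigid load** `rigid S` of a set is what it receives independently of its own allowance — the basis parts of its
  demanding coloop-triples and the overflow of its `Ls`-demanders — defined by recursion on `|S|` (the overflow into `S` is
  decided at the smaller sets `S ∖ y`).
(Dem) is then EXACT-or-better by construction (`C025ProfileStagedDem`), and (Cap) on `S` holds BY CONSTRUCTION as soon as
`rigid S ≤ 4` (`C025ProfileStagedCap`): the whole row reduces to the rigid bound `∀ S, ρ(S) = 4 → rigid S ≤ 4`, verified
exactly on 8,681 simple matroids of ranks `5 … 7` on `≤ 12` points (0 violations; work/lab/staged.py, +V1 +V2).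
This module: the definitions (capacity-`4` normalisation; `wStaged`), non-negativity, and the two evaluation lemmas.
-/
open scoped Matroid
namespace PercRepro
open Set Finset ThmH
namespace Staged
variable {α : Type} [DecidableEq α] (M : Matroid α) [M.Finite]

/-- The rank of a finset as a natural number. -/
noncomputable def rkN (X : Finset α) : ℕ := (M.eRk (X : Set α)).toNat

/-- `F_B = E ∖ cl B`. -/
noncomputable def outer (B : Finset α) : Finset α := gr M \ clF M B

/-- `T_B = cl B ∖ B`. -/
noncomputable def inner (B : Finset α) : Finset α := clF M B \ B

/-- `f_B = ρ(E ∖ cl B)`. -/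
noncomputable def fB (B : Finset α) : ℕ := rkN M (outer M B)

/-- `j_B = ρ(E ∖ B) − ρ(E ∖ cl B)`. -/
noncomputable def jB (B : Finset α) : ℕ := crk M B - fB M B

/-- The basis part: `1` if `x` is a coloop of `F_B`, else `f/(f+1)`. -/
noncomputable def rb (B : Finset α) (x : α) : ℚ :=
  if rkN M ((outer M B).erase x) < fB M B then 1 else (fB M B : ℚ) / ((fB M B : ℚ) + 1)

/-- The excess share `j_B / |F_B|`. -/
noncomputable def jsh (B : Finset α) : ℚ := (jB M B : ℚ) / ((outer M B).card : ℚ)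

open scoped Classical in
/-- The demanding coloops of `S`: `x ∈ S` with `ρ(S ∖ x) = 3` and `ρ(E ∖ (S ∖ x)) ≥ 4`. -/
noncomputable def dcol (S : Finset α) : Finset α :=
  S.filter (fun x => rkN M (S.erase x) = 3 ∧ 4 ≤ crk M (S.erase x))

open scoped Classical in
/-- The `Ls`-pairs of `S`: `(y, x)` with `B := S ∖ {y, x}` a demanding rank-`3` set, `y ∈ cl B`, `x ∉ cl B`. -/
noncomputable def lsPairs (S : Finset α) : Finset (α × α) :=
  (S ×ˢ S).filter (fun yx => yx.1 ≠ yx.2 ∧ rkN M ((S.erase yx.1).erase yx.2) = 3 ∧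
    4 ≤ crk M ((S.erase yx.1).erase yx.2) ∧ yx.1 ∈ clF M ((S.erase yx.1).erase yx.2) ∧
    yx.2 ∉ clF M ((S.erase yx.1).erase yx.2))

/-- The allowance of a set of rigid load `r`: `max 0 (4 − r) / #dcol S`. -/
noncomputable def allowOf (r : ℚ) (S : Finset α) : ℚ := max 0 (4 - r) / ((dcol M S).card : ℚ)

/-- **The rigid load**, by recursion on `|S|`: the basis parts of the demanding coloop-triples of `S` plus the overflow
of its `Ls`-demanders `B = S ∖ {y, x}` (their share `jsh B` minus what `S ∖ y = B ∪ {x}` allowed them). -/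
noncomputable def rigid (S : Finset α) : ℚ :=
  (∑ x ∈ dcol M S, rb M (S.erase x) x) +
  ∑ yx ∈ (lsPairs M S).attach,
    (jsh M ((S.erase yx.1.1).erase yx.1.2) -
      min (jsh M ((S.erase yx.1.1).erase yx.1.2)) (allowOf M (rigid (S.erase yx.1.1)) (S.erase yx.1.1))) /
      ((inner M ((S.erase yx.1.1).erase yx.1.2)).card : ℚ)
termination_by S.card
decreasing_by
  apply Finset.card_erase_lt_of_mem
  have h := yx.2
  unfold lsPairs at h
  rw [Finset.mem_filter, Finset.mem_product] at h
  exact h.1.1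

/-- The allowance of `S`. -/
noncomputable def allow (S : Finset α) : ℚ := allowOf M (rigid M S) S

/-- What `B` takes of its excess share at `B ∪ {x}`. -/
noncomputable def take (B : Finset α) (x : α) : ℚ := min (jsh M B) (allow M (insert x B))

/-- The overflow of `B` at `x`. -/
noncomputable def ovf (B : Finset α) (x : α) : ℚ := jsh M B - take M B x

open scoped Classical in
/-- **The staged rule** (capacity-`4` normalisation): `B` receives `rb B x + take B x` on `S = B ∪ {x}` for `x` a demanding
coloop of `S`, and `ovf B x / |T_B|` on `S = B ∪ {y, x}` for an `Ls`-pair `(y, x)` of `S`. -/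
noncomputable def wStaged (B S : Finset α) : ℚ :=
  (∑ x ∈ dcol M S, if B = S.erase x then rb M B x + take M B x else 0) +
  ∑ yx ∈ lsPairs M S, if B = (S.erase yx.1).erase yx.2 then ovf M B yx.2 / ((inner M B).card : ℚ) else 0

/-- The rule in the capacity-`1` normalisation of `profileIneq_of_cert`. -/
noncomputable def wN (B S : Finset α) : ℚ := wStaged M B S / 4

variable {M}

/-- The basis part is nonnegative. -/
theorem rb_nonneg (B : Finset α) (x : α) : 0 ≤ rb M B x := by
  unfold rb
  split_ifs
  · exact zero_le_one
  · positivity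

/-- The excess share is nonnegative. -/
theorem jsh_nonneg (B : Finset α) : 0 ≤ jsh M B := by
  unfold jsh; positivity

/-- Allowances are nonnegative. -/
theorem allowOf_nonneg (r : ℚ) (S : Finset α) : 0 ≤ allowOf M r S := by
  unfold allowOf
  apply div_nonneg (le_max_left _ _) (by positivity)

/-- The allowance of a set is nonnegative. -/
theorem allow_nonneg (S : Finset α) : 0 ≤ allow M S := allowOf_nonneg _ _

/-- What is taken is nonnegative. -/
theorem take_nonneg (B : Finset α) (x : α) : 0 ≤ take M B x :=
  le_min (jsh_nonneg B) (allow_nonneg _)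

/-- What is taken is at most the share. -/
theorem take_le_jsh (B : Finset α) (x : α) : take M B x ≤ jsh M B := min_le_left _ _

/-- What is taken is at most the allowance of `B ∪ {x}`. -/
theorem take_le_allow (B : Finset α) (x : α) : take M B x ≤ allow M (insert x B) := min_le_right _ _

/-- The overflow is nonnegative. -/
theorem ovf_nonneg (B : Finset α) (x : α) : 0 ≤ ovf M B x := by
  unfold ovf; linarith [take_le_jsh (M := M) B x]

/-- The rule is nonnegative. -/
theorem wStaged_nonneg (B S : Finset α) : 0 ≤ wStaged M B S := by
  unfold wStaged
  apply add_nonneg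
  · apply Finset.sum_nonneg
    intro x _
    split_ifs
    · exact add_nonneg (rb_nonneg _ _) (take_nonneg _ _)
    · exact le_rfl
  · apply Finset.sum_nonneg
    intro yx _
    split_ifs
    · exact div_nonneg (ovf_nonneg _ _) (by positivity)
    · exact le_rfl

/-- The normalised rule is nonnegative. -/
theorem wN_nonneg (B S : Finset α) : 0 ≤ wN M B S := by
  unfold wN; exact div_nonneg (wStaged_nonneg _ _) (by norm_num)

omit [DecidableEq α] in
/-- The finiteness of every `eRk`. -/
theorem eRk_ne_top (X : Finset α) : M.eRk (X : Set α) ≠ ⊤ := by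
  rw [← lt_top_iff_ne_top]; exact (M.isRkFinite_set _).eRk_lt_top

omit [DecidableEq α] in
/-- `rkN` is the rank: `(rkN X : ℕ∞) = ρ(X)`. -/
theorem coe_rkN (X : Finset α) : (rkN M X : ℕ∞) = M.eRk (X : Set α) := by
  unfold rkN; exact ENat.coe_toNat (eRk_ne_top X)

omit [DecidableEq α] in
/-- `rkN X = k ↔ ρ(X) = k`. -/
theorem rkN_eq_iff {X : Finset α} {k : ℕ} : rkN M X = k ↔ M.eRk (X : Set α) = (k : ℕ∞) := by
  rw [← coe_rkN]; exact_mod_cast Iff.rfl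

/-- Membership in `dcol`. -/
theorem mem_dcol {S : Finset α} {x : α} :
    x ∈ dcol M S ↔ x ∈ S ∧ rkN M (S.erase x) = 3 ∧ 4 ≤ crk M (S.erase x) := by
  unfold dcol; rw [Finset.mem_filter]

/-- Membership in `lsPairs`. -/
theorem mem_lsPairs {S : Finset α} {yx : α × α} :
    yx ∈ lsPairs M S ↔ (yx.1 ∈ S ∧ yx.2 ∈ S) ∧ yx.1 ≠ yx.2 ∧ rkN M ((S.erase yx.1).erase yx.2) = 3 ∧
      4 ≤ crk M ((S.erase yx.1).erase yx.2) ∧ yx.1 ∈ clF M ((S.erase yx.1).erase yx.2) ∧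
      yx.2 ∉ clF M ((S.erase yx.1).erase yx.2) := by
  unfold lsPairs; rw [Finset.mem_filter, Finset.mem_product]

/-- The unfolding of `rigid`: the basis parts plus the overflows (in terms of `ovf`). -/
theorem rigid_eq (S : Finset α) :
    rigid M S = (∑ x ∈ dcol M S, rb M (S.erase x) x) +
      ∑ yx ∈ lsPairs M S, ovf M ((S.erase yx.1).erase yx.2) yx.2 /
        ((inner M ((S.erase yx.1).erase yx.2)).card : ℚ) := by
  rw [rigid]
  congr 1
  rw [← Finset.sum_attach (lsPairs M S)]
  apply Finset.sum_congr rfl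
  intro yx _
  have hmem := yx.2
  rw [mem_lsPairs] at hmem
  have hins : insert yx.1.2 ((S.erase yx.1.1).erase yx.1.2) = S.erase yx.1.1 := by
    apply Finset.insert_erase
    rw [Finset.mem_erase]; exact ⟨hmem.2.1.symm, hmem.1.2⟩
  unfold ovf take allow
  rw [hins]

/-- `wStaged` on a one-point extension: `B ⊆ gr M` of rank `3` with `4 ≤ crk B`, `x ∈ gr M ∖ B` — the value is
`rb B x + take B x` when `x ∉ cl B` (the set has rank `4`), with no `Ls` term. -/
theorem wStaged_insert {B : Finset α} {x : α} (hB : rkN M B = 3) (hd : 4 ≤ crk M B) (hx : x ∉ B) :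
    wStaged M B (insert x B) = rb M B x + take M B x := by
  unfold wStaged
  have h1 : (∑ x' ∈ dcol M (insert x B), if B = (insert x B).erase x' then rb M B x' + take M B x' else 0)
      = rb M B x + take M B x := by
    have hxd : x ∈ dcol M (insert x B) := by
      rw [mem_dcol, Finset.erase_insert hx]
      exact ⟨Finset.mem_insert_self _ _, hB, hd⟩
    rw [← Finset.add_sum_erase _ _ hxd, if_pos (Finset.erase_insert hx).symm]
    rw [Finset.sum_eq_zero, add_zero]
    intro x' hx'
    rw [Finset.mem_erase] at hx'
    rw [if_neg]
    intro hEq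
    apply hx'.1
    by_contra hne
    have hxin : x ∈ (insert x B).erase x' := by
      rw [Finset.mem_erase]; exact ⟨Ne.symm hne, Finset.mem_insert_self _ _⟩
    rw [← hEq] at hxin
    exact hx hxin
  have h2 : (∑ yx ∈ lsPairs M (insert x B), if B = ((insert x B).erase yx.1).erase yx.2 then
      ovf M B yx.2 / ((inner M B).card : ℚ) else 0) = 0 := by
    apply Finset.sum_eq_zero
    intro yx hyx
    rw [mem_lsPairs] at hyx
    rw [if_neg]
    intro hEq
    have hc1 : ((insert x B).erase yx.1).card = B.card := by
      rw [Finset.card_erase_of_mem hyx.1.1, Finset.card_insert_of_notMem hx]; rfl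
    have hc2 : (((insert x B).erase yx.1).erase yx.2).card = B.card - 1 := by
      rw [Finset.card_erase_of_mem, hc1]
      rw [Finset.mem_erase]; exact ⟨hyx.2.1.symm, hyx.1.2⟩
    rw [← hEq] at hc2
    have hpos : 0 < B.card := by
      by_contra h0
      push Not at h0
      have : B = ∅ := Finset.card_eq_zero.mp (Nat.le_zero.mp h0)
      rw [this] at hB
      unfold rkN at hB
      simp at hB
    omega
  rw [h1, h2, add_zero]

/-- `wStaged` on an `Ls`-set: `B ⊆ gr M` of rank `3` with `4 ≤ crk B`, `y ∈ cl B ∖ B`, `x ∉ cl B` — the value is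
`ovf B x / |T_B|`, with no `e = 1` term. -/
theorem wStaged_insert_insert {B : Finset α} {y x : α} (hBg : B ⊆ gr M) (hB : rkN M B = 3) (hd : 4 ≤ crk M B)
    (hy : y ∈ clF M B) (hyB : y ∉ B) (hx : x ∉ clF M B) :
    wStaged M B (insert y (insert x B)) = ovf M B x / ((inner M B).card : ℚ) := by
  have hxB : x ∉ B := fun h => hx (subset_clF_self hBg h)
  have hyx : y ≠ x := fun h => hx (h ▸ hy)
  have hyS : y ∉ insert x B := by
    rw [Finset.mem_insert]; push Not; exact ⟨hyx, hyB⟩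
  set S := insert y (insert x B) with hS
  have hcard : S.card = B.card + 2 := by
    rw [hS, Finset.card_insert_of_notMem hyS, Finset.card_insert_of_notMem hxB]
  have herase : (S.erase y).erase x = B := by
    rw [hS, Finset.erase_insert hyS, Finset.erase_insert hxB]
  unfold wStaged
  have h1 : (∑ x' ∈ dcol M S, if B = S.erase x' then rb M B x' + take M B x' else 0) = 0 := by
    apply Finset.sum_eq_zero
    intro x' hx'
    rw [mem_dcol] at hx'
    rw [if_neg]
    intro hEq
    have := Finset.card_erase_of_mem hx'.1
    rw [← hEq, hcard] at this
    omega
  have h2 : (∑ yx ∈ lsPairs M S, if B = (S.erase yx.1).erase yx.2 then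
      ovf M B yx.2 / ((inner M B).card : ℚ) else 0) = ovf M B x / ((inner M B).card : ℚ) := by
    rw [Finset.sum_eq_single (y, x)]
    · rw [if_pos herase.symm]
    · intro yx hyx' hne
      rw [mem_lsPairs] at hyx'
      rw [if_neg]
      intro hEq
      apply hne
      have h1S : yx.1 ∈ S := hyx'.1.1
      have h2S : yx.2 ∈ S := hyx'.1.2
      have h1B : yx.1 ∉ B := by
        rw [hEq, Finset.mem_erase, Finset.mem_erase]; push Not; intro _ h; exact absurd rfl h
      have h2B : yx.2 ∉ B := by
        rw [hEq, Finset.mem_erase]; push Not; intro h; exact absurd rfl h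
      rw [← hEq] at hyx'
      have h1y : yx.1 = y := by
        rw [hS, Finset.mem_insert, Finset.mem_insert] at h1S
        rcases h1S with h | h | h
        · exact h
        · exact absurd (h ▸ hyx'.2.2.2.2.1) hx
        · exact absurd h h1B
      have h2x : yx.2 = x := by
        rw [hS, Finset.mem_insert, Finset.mem_insert] at h2S
        rcases h2S with h | h | h
        · exact absurd (h ▸ hy) hyx'.2.2.2.2.2
        · exact h
        · exact absurd h h2B
      exact Prod.ext h1y h2x
    · intro hnot
      exfalso
      apply hnot
      rw [mem_lsPairs]
      refine ⟨⟨Finset.mem_insert_self _ _, Finset.mem_insert_of_mem (Finset.mem_insert_self _ _)⟩, hyx, ?_⟩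
      simp only [herase]
      exact ⟨hB, hd, hy, hx⟩
  rw [h1, h2, zero_add]

end Staged
end PercRepro
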